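import Literature.Computability.FineGrained.SchoeningCoinProgram
import HarnessLib

/-!
# Schöning's random-walk algorithm for `k`-SAT, machine V: the whole program and its machine

Topic `Literature/Computability/FineGrained`; machine half of the line `SchoeningCoin*` towards the
named fact `Literature.Computability.FineGrained.schoening` (Schöning, FOCS 1999, Theorem),
continuing `SchoeningCoinProgram.lean` (one restart, `runs_restart`). The whole stack program
`prog k` is one loop over the input register laid out by the input transducer
(`inputW φ r = bits numVars ++ comma :: formW φ ++ blank :: coins`, `SchoeningCoinTransducer.lean`)
with a phase register: the header is discarded up to its comma, the formula is stashed until the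
`blank`, and from then on every popped symbol is a coin — the *ticket* of one restart, whose body
pops its own coins from the same register — exactly the recursion of `SchoeningCoin.run`
(`runs_runPhase`); then the registers are cleared and the answer bit written (`runs_prog`:
from `single inp (inputW φ r)` to `single out [bit (run φ (dOf k) (sOf φ) r)]` within
`progCost`). Compiled onto `Turing.FinTM2` by `ACom.exists_computesInTime` and composed with the
two transducers (`exists_machine`): one `TM2` machine over `Bool`, for each `k`, computing
`run φ (dOf k) (sOf φ) r` from `⟨encodeBool φ, r⟩` within `machineTime k |KCNF.encode φ| |r|`
steps, a polynomial in the formula length times `|r| + 1`.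

## References

* U. Schöning, *A probabilistic algorithm for k-SAT and constraint satisfaction problems*, Proc.
  40th FOCS (1999) 410–414 (the algorithm) [key `SchoeningFOCS1999`].
* T. Nipkow, G. Klein, *Concrete Semantics with Isabelle/HOL*, Springer 2014, Ch. 7–8 (big-step
  reasoning; compiler correctness with step counts, as in `SymbolPrograms.lean`).
* S. Arora, B. Barak, *Computational Complexity: A Modern Approach*, CUP 2009, §1.3 (machine
  composition), Def. 7.1 (probabilistic machines as machines reading a random tape).
-/

namespace Literature.Computability.FineGrained.SchoeningCoin

open _root_.Computability Complexity Complexity.ACom IPRenameM Sparsifier Turing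

variable {k : ℕ}

/-! ### The main loop -/

/-- Body of the main loop over the input register, dispatching on the phase register `md`:
header phase (`md` empty: discard, the comma opens the formula phase), formula phase
(`md = [comma]`: stash the symbol on `acc`; the `blank` pours the formula into `fam` and opens the
run phase), run phase (`md = [blank]`: the popped coin is the ticket of one restart). [folklore] -/
def mainBody (k : ℕ) (a : Γ') : RProg :=
  pop (kr KR.md) fun o => match o with
    | none => (match a with
        | Γ'.comma => push (kr KR.md) Γ'.comma
        | _ => skip)
    | some Γ'.comma => (match a with
        | Γ'.blank => pour (kr KR.hdr) (kr KR.fam) ;; push (kr KR.md) Γ'.blank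
        | _ => push (kr KR.hdr) a ;; push (kr KR.md) Γ'.comma)
    | some Γ'.blank => restartP k ;; push (kr KR.md) Γ'.blank
    | some _ => skip

/-- Clearing the registers still holding data after the loop. [folklore] -/
def cleanup : RProg := clear (kr KR.fam) ;; clear (tb TB.vt) ;; clear (kr KR.md)

/-- Writing the answer bit. [folklore] -/
def output : RProg :=
  pop (kr KR.done) fun o => match o with
    | some _ => push (kr KR.out) (Γ'.bit true)
    | none => push (kr KR.out) (Γ'.bit false)

/-- **The Schöning program** for clause width `k`. [cite: SchoeningFOCS1999, Theorem (the algorithm)] -/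
def prog (k : ℕ) : RProg := loop (kr KR.inp) (mainBody k) ;; cleanup ;; output

/-! ### The header and formula phases -/

/-- **Header phase**: the header bits are discarded, its comma opens the formula phase. [folklore] -/
theorem segRuns_header (k : ℕ) (ρ : MSt) (hdr rest : List Γ') (hh : ∀ a ∈ hdr, a ≠ Γ'.comma) :
    SegRuns (kr KR.inp) (mainBody k) (hdr ++ [Γ'.comma]) (st { ρ with inp := hdr ++ Γ'.comma :: rest, md := [] })
      (st { ρ with inp := rest, md := [Γ'.comma] }) (4 * hdr.length + 5) := by
  have hseg : ∀ (h : List Γ') (_ : ∀ a ∈ h, a ≠ Γ'.comma) (rest' : List Γ'),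
      SegRuns (kr KR.inp) (mainBody k) h (st { ρ with inp := h ++ rest', md := [] })
        (st { ρ with inp := rest', md := [] }) (4 * h.length) := by
    intro h
    induction h with
    | nil => intro _ rest'; simpa using SegRuns.nil (kr KR.inp) (mainBody k) _
    | cons a h ih =>
      intro hh' rest'
      have ha := hh' a (by simp)
      have h1 : Runs (mainBody k a) (st { ρ with inp := h ++ rest', md := [] })
          (st { ρ with inp := h ++ rest', md := [] }) 2 := by
        unfold mainBody
        refine Runs.pop_nil (by simp) ?_
        cases a <;> first | exact absurd rfl ha | exact Runs.skip _
      have h2 := ih (fun a ha => hh' a (by simp [ha])) rest'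
      refine (SegRuns.cons' (st_inp _) (by simp) h1 h2).of_eq rfl ?_
      simp only [List.length_cons]; omega
  have hc : Runs (mainBody k Γ'.comma) (st { ρ with inp := rest, md := [] })
      (st { ρ with inp := rest, md := [Γ'.comma] }) 3 := by
    unfold mainBody
    refine Runs.pop_nil (by simp) ?_
    exact (Runs.push (kr KR.md) Γ'.comma _).of_eq (by simp) le_rfl
  refine ((hseg hdr hh (Γ'.comma :: rest)).append (SegRuns.single (st_inp _) (by simpa using hc))).of_eq rfl ?_
  omega

/-- **Formula phase**: the formula symbols are stashed (reversed) on `acc`; the `blank` pours them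
into `fam` and opens the run phase. [folklore] -/
theorem segRuns_formula (k : ℕ) (ρ : MSt) (F rest : List Γ') (hF : Γ'.blank ∉ F) :
    SegRuns (kr KR.inp) (mainBody k) (F ++ [Γ'.blank])
      (st { ρ with inp := F ++ Γ'.blank :: rest, md := [Γ'.comma], acc := [], fam := [] })
      (st { ρ with inp := rest, md := [Γ'.blank], acc := [], fam := F }) (6 * F.length + (3 * F.length + 7)) := by
  have hseg : ∀ (G : List Γ') (_ : Γ'.blank ∉ G) (acc₀ rest' : List Γ'),
      SegRuns (kr KR.inp) (mainBody k) G (st { ρ with inp := G ++ rest', md := [Γ'.comma], acc := acc₀, fam := [] })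
        (st { ρ with inp := rest', md := [Γ'.comma], acc := G.reverse ++ acc₀, fam := [] }) (6 * G.length) := by
    intro G
    induction G with
    | nil => intro _ acc₀ rest'; simpa using SegRuns.nil (kr KR.inp) (mainBody k) _
    | cons a G ih =>
      intro hG acc₀ rest'
      have ha : a ≠ Γ'.blank := fun e => hG (by simp [e])
      have h1 : Runs (mainBody k a) (st { ρ with inp := G ++ rest', md := [Γ'.comma], acc := acc₀, fam := [] })
          (st { ρ with inp := G ++ rest', md := [Γ'.comma], acc := a :: acc₀, fam := [] }) 4 := by
        unfold mainBody
        refine Runs.pop_cons (st_md _) ?_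
        simp only [update_st_md]
        have h2 : ∀ a' : Γ', Runs (push (kr KR.hdr) a' ;; push (kr KR.md) Γ'.comma)
            (st { ρ with inp := G ++ rest', md := [], acc := acc₀, fam := [] })
            (st { ρ with inp := G ++ rest', md := [Γ'.comma], acc := a' :: acc₀, fam := [] }) 2 := fun a' =>
          ((Runs.push (kr KR.hdr) a' _).seq (Runs.push (kr KR.md) Γ'.comma _)).of_eq (by simp) le_rfl
        cases a <;> first | exact absurd rfl ha | exact h2 _
      have h2 := ih (fun h => hG (List.mem_cons_of_mem _ h)) (a :: acc₀) rest'
      refine (SegRuns.cons' (st_inp _) (by simp) h1 h2).of_eq (by simp) ?_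
      simp only [List.length_cons]; omega
  have hb : Runs (mainBody k Γ'.blank) (st { ρ with inp := rest, md := [Γ'.comma], acc := F.reverse, fam := [] })
      (st { ρ with inp := rest, md := [Γ'.blank], acc := [], fam := F }) (3 * F.length + 5) := by
    unfold mainBody
    rw [show 3 * F.length + 5 = (3 * F.length + 3) + 2 by ring]
    have h1 := runs_pour (a := kr KR.hdr) (b := kr KR.fam) (by decide)
      (st { ρ with inp := rest, md := [], acc := F.reverse, fam := [] })
    simp only [st_acc, st_fam, List.append_nil, List.reverse_reverse, List.length_reverse, update_st_acc,
      update_st_fam] at h1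
    have h2 := Runs.push (kr KR.md) Γ'.blank (st { ρ with inp := rest, md := [], acc := [], fam := F })
    simp only [st_md, update_st_md] at h2
    exact Runs.pop_cons (st_md _) (by simpa only [update_st_md] using (h1.seq h2).of_eq rfl (by omega))
  have hs := hseg F hF [] (Γ'.blank :: rest)
  simp only [List.append_nil] at hs
  refine (hs.append (SegRuns.single (st_inp _) (by simpa using hb))).of_eq rfl (by omega)

/-! ### The run phase -/

/-- The budget of one ticket of the run phase: a full restart from an assignment word of length at
most `(S + 1) W`, plus the loop and phase bookkeeping. [folklore] -/
def ticketCost (k W S : ℕ) : ℕ := restartCost k W S ((S + 1) * W) + 5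

/-- **Run phase, success recorded**: once `done` is up every remaining coin costs `8` steps and
changes nothing else. [folklore] -/
theorem runs_runPhase_done (k : ℕ) (ρ : MSt) (fam vt : List Γ') (cs : List Bool) :
    Runs (loop (kr KR.inp) (mainBody k)) (st (walkSt { ρ with md := [Γ'.blank] } fam vt (cs.map Γ'.bit) [Γ'.blank] []))
      (st (walkSt { ρ with md := [Γ'.blank] } fam vt [] [Γ'.blank] [])) (8 * cs.length + 1) := by
  have h := runs_loop_inv (k := kr KR.inp) (f := mainBody k)
    (fun _ rest => st (walkSt { ρ with md := [Γ'.blank] } fam vt rest [Γ'.blank] [])) (fun _ _ => True) 6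
    (fun _ _ _ => by simp [walkSt]) (fun done a rest _ => ⟨trivial, by
      unfold mainBody
      refine (Runs.pop_cons (a := Γ'.blank) (w := []) (by simp [walkSt]) ?_).of_eq rfl (le_refl _)
      have h1 := runs_restart_done k { ρ with md := [] } fam vt rest
      have h2 := Runs.push (kr KR.md) Γ'.blank (st (walkSt { ρ with md := [] } fam vt rest [Γ'.blank] []))
      refine ((by simpa [walkSt] using h1 : Runs (restartP k) _ _ 3).seq h2).of_eq ?_ (by omega)
      simp [walkSt]⟩)
    (cs.map Γ'.bit) [] trivial
  simp only [List.length_map] at h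
  exact h.of_eq rfl (by omega)

/-- **Run phase** (`done` down): the loop over the coins computes `SchoeningCoin.run` — every
popped coin is the ticket of one restart (`runs_restart`), and the recursion of `run`
(`run (b :: cs) = (restart cs).1 || run (restart cs).2`) is the loop's. The final assignment word
is some word of length at most `(S + 1) W`. [cite: SchoeningFOCS1999, Theorem (the algorithm: the outer loop of restarts)] -/
theorem runs_runPhase (hk : 1 ≤ k) (φ : KCNF k) (ρ : MSt) : ∀ (n : ℕ) (cs : List Bool) (vt₀ : List Γ'),
    cs.length ≤ n → vt₀.length ≤ (sOf φ + 1) * (formW φ).length →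
    ∃ vt₁ : List Γ', vt₁.length ≤ (sOf φ + 1) * (formW φ).length ∧
      Runs (loop (kr KR.inp) (mainBody k))
        (st (walkSt { ρ with md := [Γ'.blank] } (formW φ) vt₀ (cs.map Γ'.bit) [] []))
        (st (walkSt { ρ with md := [Γ'.blank] } (formW φ) vt₁ []
          (flagW Γ'.blank (run φ (dOf k) (sOf φ) cs = true)) []))
        (ticketCost k (formW φ).length (sOf φ) * cs.length + 1)
  | n, [], vt₀, _, hvt => ⟨vt₀, hvt, by
      simpa using Runs.loop_nil (mainBody k)
        (R := st (walkSt { ρ with md := [Γ'.blank] } (formW φ) vt₀ [] [] [])) (by simp [walkSt])⟩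
  | 0, b :: cs, vt₀, hn, _ => by simp at hn
  | n + 1, b :: cs, vt₀, hn, hvt => by
    -- one ticket: a restart
    have hr := runs_restart hk φ { ρ with md := [] } vt₀ cs
    set res := restartS φ (dOf k) (sOf φ) cs with hres
    have hlen : res.2.2.length ≤ cs.length := by
      have := length_restart φ (dOf k) (sOf φ) cs
      rw [← restartS_snd] at this; exact this
    have hvt1 : (cbody res.1).length ≤ (sOf φ + 1) * (formW φ).length := length_cbody_restartS_le φ _ cs
    have hbody : Runs (mainBody k (Γ'.bit b))
        (st (walkSt { ρ with md := [Γ'.blank] } (formW φ) vt₀ (cs.map Γ'.bit) [] []))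
        (st (walkSt { ρ with md := [Γ'.blank] } (formW φ) (cbody res.1) (res.2.2.map Γ'.bit)
          (flagW Γ'.blank (res.2.1 = true)) []))
        (restartCost k (formW φ).length (sOf φ) ((sOf φ + 1) * (formW φ).length) + 3) := by
      unfold mainBody
      refine (Runs.pop_cons (a := Γ'.blank) (w := []) (by simp [walkSt]) ?_).of_eq rfl (le_refl _)
      have h2 := Runs.push (kr KR.md) Γ'.blank
        (st (walkSt { ρ with md := [] } (formW φ) (cbody res.1) (res.2.2.map Γ'.bit) (flagW Γ'.blank (res.2.1 = true)) []))
      refine ((by simpa [walkSt] using hr : Runs (restartP k) _ _ (restartCost k (formW φ).length (sOf φ) vt₀.length)).seq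
        h2).of_eq (by simp [walkSt]) ?_
      have := restartCost_mono k (formW φ).length (sOf φ) hvt
      omega
    rw [run_cons, ← restartS_snd, ← hres]
    have ht : ticketCost k (formW φ).length (sOf φ) =
        restartCost k (formW φ).length (sOf φ) ((sOf φ + 1) * (formW φ).length) + 5 := rfl
    have h8 : 8 ≤ ticketCost k (formW φ).length (sOf φ) := by unfold ticketCost restartCost; omega
    have hmul := Nat.mul_le_mul_left (ticketCost k (formW φ).length (sOf φ)) hlen
    have h8r : 8 * res.2.2.length ≤ ticketCost k (formW φ).length (sOf φ) * cs.length :=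
      le_trans (Nat.mul_le_mul_right _ h8) hmul
    cases hb1 : res.2.1 with
    | true =>
      -- success: the remaining coins are idle tickets
      refine ⟨cbody res.1, hvt1, ?_⟩
      have hd := runs_runPhase_done k ρ (formW φ) (cbody res.1) res.2.2
      rw [hb1, flagW_true _ rfl] at hbody
      simp only [Bool.true_or]
      rw [flagW_true _ trivial]
      refine (Runs.loop_cons (st_inp _) (by simpa [walkSt] using hbody) hd).of_eq rfl ?_
      rw [List.length_cons, Nat.mul_succ]
      omega
    | false =>
      -- failure: recurse on the remaining coins
      rw [hb1, flagW_false _ (by simp)] at hbody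
      obtain ⟨vt₁, hvt₁, hrec⟩ := runs_runPhase hk φ ρ n res.2.2 (cbody res.1) (by simp at hn; omega) hvt1
      refine ⟨vt₁, hvt₁, ?_⟩
      simp only [Bool.false_or]
      refine (Runs.loop_cons (st_inp _) (by simpa [walkSt] using hbody) hrec).of_eq rfl ?_
      rw [List.length_cons, Nat.mul_succ]
      omega


/-! ### The whole program -/

/-- The budget of the whole program on `φ` with `rlen` coins. [folklore] -/
def progCost (k : ℕ) (φ : KCNF k) (rlen : ℕ) : ℕ :=
  (4 * (encodeNat φ.numVars).length + 5 + (6 * (formW φ).length + (3 * (formW φ).length + 7)) +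
    (ticketCost k (formW φ).length (sOf φ) * rlen + 1) + 1) +
  ((2 * (formW φ).length + 1) + (2 * ((sOf φ + 1) * (formW φ).length) + 1) + 3) + 3

/-- **Specification of the Schöning program**: from the layout `inputW φ r` in the input register
(everything else empty) to the answer bit `run φ (dOf k) (sOf φ) r` in the output register
(everything else empty), within `progCost`. [cite: SchoeningFOCS1999, Theorem (the algorithm)] -/
theorem runs_prog (hk : 1 ≤ k) (φ : KCNF k) (r : List Bool) :
    Runs (prog k) (AStore.single (kr KR.inp) (inputW φ r))
      (AStore.single (kr KR.out) [Γ'.bit (run φ (dOf k) (sOf φ) r)]) (progCost k φ r.length) := by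
  rw [single_inp, single_out]
  unfold prog progCost
  -- the three phases of the loop
  have s1 := segRuns_header k MSt.zero ((encodeNat φ.numVars).map Γ'.bit) (formW φ ++ Γ'.blank :: r.map Γ'.bit) (by
    intro a ha; simp only [List.mem_map] at ha; obtain ⟨b, _, rfl⟩ := ha; exact fun h => Γ'.noConfusion h)
  have s2 := segRuns_formula k MSt.zero (formW φ) (r.map Γ'.bit) (blank_not_mem_formW φ)
  obtain ⟨vt₁, hvt₁, s3⟩ := runs_runPhase hk φ MSt.zero r.length r [] le_rfl (by simp)
  have hloop := (s1.append (by simpa [MSt.zero] using s2)).runs_loop (by simpa [walkSt, MSt.zero] using s3)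
  simp only [List.length_map] at hloop
  have e0 : st { MSt.zero with inp := inputW φ r } =
      st { MSt.zero with inp := (encodeNat φ.numVars).map Γ'.bit ++ Γ'.comma :: (formW φ ++ Γ'.blank :: r.map Γ'.bit), md := [] } := by
    simp [inputW, MSt.zero]
  rw [e0]
  -- cleanup
  set dn := flagW Γ'.blank (run φ (dOf k) (sOf φ) r = true) with hdn
  have c1 := runs_clear (kr KR.fam) (st (walkSt { MSt.zero with md := [Γ'.blank] } (formW φ) vt₁ [] dn []))
  simp only [walkSt, st_fam, update_st_fam] at c1
  have c2 := runs_clear (tb TB.vt)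
    (st { MSt.zero with
      md := [Γ'.blank], fam := [], vt := vt₁, inp := [], done := dn, cy := [], fam2 := [], pr := [], val := [], res := []
      clR := [], cl := [], fl := [], iu := [], c := [], c2 := [], t1 := [], t2 := [] })
  simp only [st_vt, update_st_vt] at c2
  have c3 := runs_clear (kr KR.md)
    (st { MSt.zero with
      md := [Γ'.blank], fam := [], vt := [], inp := [], done := dn, cy := [], fam2 := [], pr := [], val := [], res := []
      clR := [], cl := [], fl := [], iu := [], c := [], c2 := [], t1 := [], t2 := [] })
  simp only [st_md, update_st_md, List.length_singleton] at c3
  have hclean : Runs cleanup (st (walkSt { MSt.zero with md := [Γ'.blank] } (formW φ) vt₁ [] dn []))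
      (st { MSt.zero with done := dn })
      ((2 * (formW φ).length + 1) + (2 * ((sOf φ + 1) * (formW φ).length) + 1) + 3) := by
    unfold cleanup
    refine ((by simpa [walkSt] using c1 : Runs (clear (kr KR.fam)) _ _ (2 * (formW φ).length + 1)).seq
      (c2.seq c3)).of_eq ?_ ?_
    · simp [MSt.zero]
    · omega
  -- output
  have hout : Runs output (st { MSt.zero with done := dn })
      (st { MSt.zero with out := [Γ'.bit (run φ (dOf k) (sOf φ) r)] }) 3 := by
    unfold output
    cases hrun : run φ (dOf k) (sOf φ) r with
    | true =>
      rw [hdn, hrun, flagW_true _ rfl]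
      refine Runs.pop_cons (st_done _) ?_
      exact (Runs.push (kr KR.out) (Γ'.bit true) _).of_eq (by simp [MSt.zero]) le_rfl
    | false =>
      rw [hdn, hrun, flagW_false _ (by simp)]
      refine Runs.pop_nil (by simp [MSt.zero]) ?_
      exact (Runs.push (kr KR.out) (Γ'.bit false) _).of_eq (by simp [MSt.zero]) le_rfl
  exact (hloop.seq (hclean.seq hout)).of_eq rfl (by omega)

/-! ### The machine -/

/-- The running time of the whole machine on a formula with layout of length `ilen = |inputW φ r|`:
input stage, program, output stage. [folklore] -/
def machineTime (k : ℕ) (φ : KCNF k) (rlen ilen : ℕ) : ℕ := 5 + ((progCost k φ rlen + 1) + (2 * ilen + 3))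

/-- **The Schöning machine.** For every `k ≥ 1` there is one multi-stack machine over `Bool` which,
on every input `⟨encodeBool φ, r⟩` (any `k`-CNF `φ`, any coin string `r`), outputs the bit
`run φ (dOf k) (sOf φ) r` of the coin-string algorithm within `machineTime` steps: the input
transducer, the compiled stack program, the output transducer.
[cite: SchoeningFOCS1999, Theorem (the algorithm, as a machine reading its random bits from the input)] -/
theorem exists_machine (hk : 1 ≤ k) :
    ∃ M : TM2ComputableAux Bool Bool, ∀ (φ : KCNF k) (r : List Bool),
      M.OutputsWithin (boolPair φ.encodeBool r) (encodeBool (run φ (dOf k) (sOf φ) r))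
        (machineTime k φ r.length (boolPair φ.encodeBool r).length) := by
  obtain ⟨M₀, h₀⟩ := exists_inputStage
  obtain ⟨M₁, h₁⟩ := ACom.exists_computesInTime (prog k) (kr KR.inp) (kr KR.out)
    (fun p : KCNF k × List Bool => inputW p.1 p.2) (fun b : Bool => [Γ'.bit b])
    (fun p => run p.1 (dOf k) (sOf p.1) p.2) (fun p => progCost k p.1 p.2.length)
    (fun p => runs_prog hk p.1 p.2)
  obtain ⟨M₂, h₂⟩ := exists_outputStage
  refine ⟨(M₀.comp M₁).comp M₂, fun φ r => ?_⟩
  have H₁ : M₁.OutputsWithin (inputW φ r) [Γ'.bit (run φ (dOf k) (sOf φ) r)] (progCost k φ r.length + 1) := h₁ (φ, r)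
  have := TM2ComputableAux.comp_outputsWithin _ _ (TM2ComputableAux.comp_outputsWithin _ _ (h₀ k φ r) H₁) (h₂ _)
  exact this

end Literature.Computability.FineGrained.SchoeningCoin
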